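import Mathlib.LinearAlgebra.Matrix.NonsingularInverse
import Mathlib.LinearAlgebra.LinearIndependent.Defs
import Mathlib.Data.Real.Basic
import Mathlib.Order.Bounds.Basic
import Mathlib.Tactic.Linarith
import Mathlib.Tactic.FinCases
import HarnessLib

/-!
# Variables with upper bounds: the Upper Bound Optimality Theorem (Luenberger–Ye, §3.6)

[LY08] = D. G. Luenberger, Y. Ye, *Linear and Nonlinear Programming* [LuenbergerYe2008], chapter
"The Simplex Method" (Ch. 3 in the held copy `book:luenberger2008-linear-nonlinear-programming` and in
the Springer 2008 printing), §3.6 "Variables with upper bounds", display (29), the Definition of an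
extended basic feasible solution, the **Upper Bound Optimality Theorem**, Steps 1–3 of the procedure
and the worked Example.

Setting (29): `minimize cᵀx subject to Ax = b, 0 ≤ x ≤ h` (`BoxFeasible`).  An *extended basic
feasible solution* is a feasible point at which the nonbasic variables sit at a bound (`0` or `h_j`)
and the basic columns are linearly independent (`IsExtendedBasic`).  With multipliers `λ` pricing out
the basic columns (`λᵀa_j = c_j`, as for the simplex multipliers of §3.7/§4.3) the relative cost
vector is `r = c − Aᵀλ` (`relCost`).

Results recorded:
* `cost_eq_of_constraint` — the identity behind (22)/(33): for `Ay = b`,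
  `cᵀy = λᵀb + rᵀy`; hence `cost_sub_cost_eq` — `cᵀy − cᵀx = rᵀ(y − x)` for two solutions of
  `Ax = b`;
* `upperBound_optimality` — **Upper Bound Optimality Theorem**: a feasible `x` is optimal for (29)
  as soon as, for every variable, `r_j = 0`, or `x_j = 0` with `r_j ≥ 0`, or `x_j = h_j` with
  `r_j ≤ 0` ("`r_j ≥ 0` if `x_j = 0`, `r_j ≤ 0` if `x_j = h_j`" for the nonbasic variables, the basic
  ones pricing out exactly); `upperBound_optimality_isMinOn` / `upperBound_optimality_basic` are the
  `IsMinOn` form and the form with an explicit basic index set;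
* the move of the procedure (Step 2): changing one nonbasic variable by `θ` along a direction `d`
  with `Ad = 0` keeps `Ax = b` (`constraint_move`), changes the cost by `θ·rᵀd`
  (`cost_move`), and stays in the box `0 ≤ x ≤ h` exactly as long as `θ` does not exceed the
  ratios (a) `h_j − x_j` over `d_j > 0` and (b)/(c) `x_j` over `−d_j` for `d_j < 0`
  (`box_move_of_le_ratios`) — the three numbers of Step 2 are these ratios for the edge direction
  of the extended tableau;
* the worked Example of §3.6 (`exA`, `exb`, `exc`, `exh`): the point `x = (7, 1, 1, 3, 0)` found
  by the procedure is certified optimal by the theorem with `λ = (4, 1)`, `r = (−2, 0, −3, 0, 1)`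
  (`boundedExample_relCost`, `boundedExample_optimal`), optimal value `12` (`boundedExample_value`).

Published results only (Lean placement rule): every public declaration carries its
`[cite: LuenbergerYe2008, §3.6 …]` locator.
-/

namespace Literature.Analysis.Convex.SimplexUpperBounds

open Matrix

variable {m n : Type*} [Fintype m] [Fintype n]

/-- Feasibility for the linear program with upper bounds in standard form (29):
`Ax = b`, `0 ≤ x ≤ h`. [cite: LuenbergerYe2008, §3.6 (29)] -/
def BoxFeasible (A : Matrix m n ℝ) (b : m → ℝ) (h : n → ℝ) (x : n → ℝ) : Prop :=
  A *ᵥ x = b ∧ ∀ j, 0 ≤ x j ∧ x j ≤ h j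

/-- **Definition (§3.6).** An *extended basic feasible solution* of (29) with basic index set `B`:
a feasible point whose nonbasic variables are each equal to their lower bound `0` or their upper
bound `h_j`, the basic variables corresponding to linearly independent columns of `A`.
[cite: LuenbergerYe2008, §3.6 Definition (extended basic feasible solution)] -/
def IsExtendedBasic (A : Matrix m n ℝ) (b : m → ℝ) (h : n → ℝ) (x : n → ℝ) (B : Set n) : Prop :=
  BoxFeasible A b h x ∧ (∀ j, j ∉ B → x j = 0 ∨ x j = h j) ∧
    LinearIndependent ℝ (fun j : B => Aᵀ (j : n))

/-- Nondegeneracy assumption of §3.6: the basic variables take values strictly between their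
bounds. [cite: LuenbergerYe2008, §3.6 (nondegenerate extended basic feasible solution)] -/
def IsNondegenerate (h : n → ℝ) (x : n → ℝ) (B : Set n) : Prop :=
  ∀ j, j ∈ B → 0 < x j ∧ x j < h j

/-- The relative cost vector with respect to multipliers `λ`: `r = c − Aᵀλ`
(`r_j = c_j − λᵀa_j`; the basic columns price out, `r_j = 0`, when `λ` are the simplex
multipliers of the basis). [cite: LuenbergerYe2008, §3.6 Fig. 3.3 (relative cost coefficients r_j
of the extended tableau); §3.7 (34)] -/
def relCost (A : Matrix m n ℝ) (c : n → ℝ) (lam : m → ℝ) : n → ℝ := c - Aᵀ *ᵥ lam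

omit [Fintype n] in
/-- Componentwise: `r_j = c_j − (Aᵀλ)_j`. [cite: LuenbergerYe2008, §3.6 Fig. 3.3; §3.7 (34)] -/
theorem relCost_apply (A : Matrix m n ℝ) (c : n → ℝ) (lam : m → ℝ) (j : n) :
    relCost A c lam j = c j - (Aᵀ *ᵥ lam) j := rfl

/-- The identity behind (22)/(33): for any `y` with `Ay = b`, `cᵀy = λᵀb + rᵀy`.
[cite: LuenbergerYe2008, §3.6 proof of the Upper Bound Optimality Theorem ("This follows directly
from (22)"); §3.3 (22); §3.7 (33)] -/
theorem cost_eq_of_constraint (A : Matrix m n ℝ) (c : n → ℝ) (lam : m → ℝ) {b : m → ℝ}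
    {y : n → ℝ} (hy : A *ᵥ y = b) :
    c ⬝ᵥ y = lam ⬝ᵥ b + relCost A c lam ⬝ᵥ y := by
  have h1 : (Aᵀ *ᵥ lam) ⬝ᵥ y = lam ⬝ᵥ b := by
    rw [mulVec_transpose, ← dotProduct_mulVec, hy]
  unfold relCost
  rw [sub_dotProduct, h1]
  ring

/-- For two solutions of `Ax = b` the cost difference is `cᵀy − cᵀx = rᵀ(y − x)`, whatever the
multipliers `λ`. [cite: LuenbergerYe2008, §3.6 proof of the Upper Bound Optimality Theorem; §3.3 (22)] -/
theorem cost_sub_cost_eq (A : Matrix m n ℝ) (c : n → ℝ) (lam : m → ℝ) {b : m → ℝ}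
    {x y : n → ℝ} (hx : A *ᵥ x = b) (hy : A *ᵥ y = b) :
    c ⬝ᵥ y - c ⬝ᵥ x = relCost A c lam ⬝ᵥ (y - x) := by
  rw [cost_eq_of_constraint A c lam hx, cost_eq_of_constraint A c lam hy, dotProduct_sub]
  ring

/-- **Upper Bound Optimality Theorem (§3.6).** Let `x` be feasible for (29) and let `λ` be
multipliers with relative costs `r = c − Aᵀλ` such that, for every variable, either `r_j = 0`
(the basic variables), or `x_j = 0` and `r_j ≥ 0`, or `x_j = h_j` and `r_j ≤ 0`.  Then `x` is
optimal: `cᵀx ≤ cᵀy` for every feasible `y`.  Proof as in the text, from (22):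
`cᵀy − cᵀx = Σ_j r_j(y_j − x_j)` and every term is nonnegative.
[cite: LuenbergerYe2008, §3.6 Upper Bound Optimality Theorem] -/
theorem upperBound_optimality {A : Matrix m n ℝ} {b : m → ℝ} {h c : n → ℝ} {x : n → ℝ}
    (lam : m → ℝ) (hx : BoxFeasible A b h x)
    (hr : ∀ j, relCost A c lam j = 0 ∨ (x j = 0 ∧ 0 ≤ relCost A c lam j) ∨
      (x j = h j ∧ relCost A c lam j ≤ 0))
    {y : n → ℝ} (hy : BoxFeasible A b h y) : c ⬝ᵥ x ≤ c ⬝ᵥ y := by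
  have key : 0 ≤ relCost A c lam ⬝ᵥ (y - x) := by
    unfold dotProduct
    refine Finset.sum_nonneg fun j _ => ?_
    rcases hr j with h0 | ⟨hx0, hr0⟩ | ⟨hxh, hr0⟩
    · rw [h0, zero_mul]
    · have : 0 ≤ (y - x) j := by rw [Pi.sub_apply, hx0, sub_zero]; exact (hy.2 j).1
      exact mul_nonneg hr0 this
    · have : (y - x) j ≤ 0 := by rw [Pi.sub_apply, hxh, sub_nonpos]; exact (hy.2 j).2
      exact mul_nonneg_of_nonpos_of_nonpos hr0 this
  have := cost_sub_cost_eq A c lam hx.1 hy.1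
  linarith

/-- `IsMinOn` form of the Upper Bound Optimality Theorem: `x` minimises `cᵀ·` over the feasible
set of (29). [cite: LuenbergerYe2008, §3.6 Upper Bound Optimality Theorem] -/
theorem upperBound_optimality_isMinOn {A : Matrix m n ℝ} {b : m → ℝ} {h c : n → ℝ} {x : n → ℝ}
    (lam : m → ℝ) (hx : BoxFeasible A b h x)
    (hr : ∀ j, relCost A c lam j = 0 ∨ (x j = 0 ∧ 0 ≤ relCost A c lam j) ∨
      (x j = h j ∧ relCost A c lam j ≤ 0)) :
    IsMinOn (fun y => c ⬝ᵥ y) {y | BoxFeasible A b h y} x :=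
  fun _ hy => upperBound_optimality lam hx hr hy

/-- The theorem in the wording of the text: an extended basic feasible solution with basic set
`B`, multipliers pricing out the basic columns (`λᵀa_j = c_j` for `j ∈ B`), and nonbasic relative
costs satisfying `r_j ≥ 0` if `x_j = 0` and `r_j ≤ 0` if `x_j = h_j`, is optimal for (29).
[cite: LuenbergerYe2008, §3.6 Upper Bound Optimality Theorem] -/
theorem upperBound_optimality_basic {A : Matrix m n ℝ} {b : m → ℝ} {h c : n → ℝ} {x : n → ℝ}
    {B : Set n} (lam : m → ℝ) (hx : BoxFeasible A b h x)
    (hbasic : ∀ j, j ∈ B → (Aᵀ *ᵥ lam) j = c j)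
    (hnonbasic : ∀ j, j ∉ B → (x j = 0 ∧ 0 ≤ relCost A c lam j) ∨
      (x j = h j ∧ relCost A c lam j ≤ 0))
    {y : n → ℝ} (hy : BoxFeasible A b h y) : c ⬝ᵥ x ≤ c ⬝ᵥ y := by
  refine upperBound_optimality lam hx (fun j => ?_) hy
  by_cases hj : j ∈ B
  · left
    rw [relCost_apply, hbasic j hj, sub_self]
  · right
    exact hnonbasic j hj

/-! ### The move of the procedure (Steps 2–3) -/

omit [Fintype m] in
/-- Moving along a direction `d` of the null space of `A` keeps the equality constraints:
`A(x + θd) = b`. (In §3.6 the direction raises one nonbasic variable and adjusts the basic ones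
through the tableau column, `d_B = −y_j`.) [cite: LuenbergerYe2008, §3.6 Steps 2–3 (the nonbasic
variable is changed continuously while the basic variables keep Ax = b)] -/
theorem constraint_move {A : Matrix m n ℝ} {b : m → ℝ} {x d : n → ℝ} (hx : A *ᵥ x = b)
    (hd : A *ᵥ d = 0) (θ : ℝ) : A *ᵥ (x + θ • d) = b := by
  rw [mulVec_add, mulVec_smul, hd, smul_zero, add_zero, hx]

/-- Along such a move the cost changes linearly with slope `rᵀd`:
`cᵀ(x + θd) = cᵀx + θ·rᵀd` (for the edge direction of the extended tableau `rᵀd = ± r_j`, the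
relative cost of the moving variable, Step 1). [cite: LuenbergerYe2008, §3.6 Step 1 and the
paragraph before the Upper Bound Optimality Theorem (a change is beneficial iff the relative cost
coefficient has the right sign)] -/
theorem cost_move {A : Matrix m n ℝ} (c : n → ℝ) (lam : m → ℝ) {x d : n → ℝ}
    (hd : A *ᵥ d = 0) (θ : ℝ) :
    c ⬝ᵥ (x + θ • d) = c ⬝ᵥ x + θ * (relCost A c lam ⬝ᵥ d) := by
  have h1 : (Aᵀ *ᵥ lam) ⬝ᵥ d = 0 := by
    rw [mulVec_transpose, ← dotProduct_mulVec, hd, dotProduct_zero]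
  unfold relCost
  rw [dotProduct_add, dotProduct_smul, sub_dotProduct, h1, sub_zero, smul_eq_mul]

omit [Fintype m] [Fintype n] in
/-- **Step 2 (ratio test with upper bounds).** Starting from a point of the box `0 ≤ x ≤ h` and
moving by `θ ≥ 0` along `d`, the new point stays in the box provided `θ` does not exceed
(a) `(h_j − x_j)/d_j` for every `d_j > 0` (a rising variable reaches its upper bound) and
(b)/(c) `x_j/(−d_j)` for every `d_j < 0` (a falling variable reaches its lower bound); the
smallest of these numbers is the step actually taken in Step 3.
[cite: LuenbergerYe2008, §3.6 Step 2 (a)–(c) and Step 3] -/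
theorem box_move_of_le_ratios {h x d : n → ℝ} (hx : ∀ j, 0 ≤ x j ∧ x j ≤ h j) {θ : ℝ}
    (hθ : 0 ≤ θ) (ha : ∀ j, 0 < d j → θ * d j ≤ h j - x j)
    (hb : ∀ j, d j < 0 → θ * (-d j) ≤ x j) (j : n) :
    0 ≤ (x + θ • d) j ∧ (x + θ • d) j ≤ h j := by
  simp only [Pi.add_apply, Pi.smul_apply, smul_eq_mul]
  obtain ⟨hx0, hxh⟩ := hx j
  rcases lt_trichotomy (d j) 0 with hneg | hzero | hpos
  · have := hb j hneg
    constructor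
    · nlinarith
    · nlinarith
  · rw [hzero, mul_zero, add_zero]
    exact ⟨hx0, hxh⟩
  · have := ha j hpos
    constructor
    · nlinarith
    · linarith

omit [Fintype m] [Fintype n] in
/-- Case (a) of Step 3 for the moving variable itself: with `d_j = 1` the bound (a) reads
`θ ≤ h_j − x_j`; started from the lower bound `x_j = 0` this is `θ ≤ h_j`, the number (a) of Step 2.
[cite: LuenbergerYe2008, §3.6 Step 2 (a), Step 3 (a)] -/
theorem ratio_a_of_lower {h x d : n → ℝ} {j : n} (hxj : x j = 0) (hdj : d j = 1) (θ : ℝ) :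
    θ * d j ≤ h j - x j ↔ θ ≤ h j := by
  rw [hdj, hxj, mul_one, sub_zero]

/-! ### The worked Example of §3.6 -/

/-- Constraint matrix of the Example: `x₁ + x₃ − x₄ + 2x₅ = 5`, `x₂ + 2x₃ + 2x₄ + x₅ = 9`.
[cite: LuenbergerYe2008, §3.6 Example] -/
def exA : Matrix (Fin 2) (Fin 5) ℝ := !![1, 0, 1, -1, 2; 0, 1, 2, 2, 1]

/-- Right-hand side `b = (5, 9)` of the Example. [cite: LuenbergerYe2008, §3.6 Example] -/
def exb : Fin 2 → ℝ := ![5, 9]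

/-- Cost vector `c = (2, 1, 3, −2, 10)` of the Example. [cite: LuenbergerYe2008, §3.6 Example] -/
def exc : Fin 5 → ℝ := ![2, 1, 3, -2, 10]

/-- Upper bounds `h = (7, 10, 1, 5, 3)` of the Example. [cite: LuenbergerYe2008, §3.6 Example] -/
def exh : Fin 5 → ℝ := ![7, 10, 1, 5, 3]

/-- The solution reported by the procedure: `x = (7, 1, 1, 3, 0)` (`x₁`, `x₃` at their upper
bounds, `x₅` at its lower bound, `x₂`, `x₄` basic). [cite: LuenbergerYe2008, §3.6 Example
(final solution)] -/
def exX : Fin 5 → ℝ := ![7, 1, 1, 3, 0]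

/-- Multipliers pricing out the basic columns `a₂`, `a₄` of the final solution: `λ = (4, 1)`.
[cite: LuenbergerYe2008, §3.6 Example (final tableau)] -/
def exLam : Fin 2 → ℝ := ![4, 1]

/-- The reported point is feasible for the Example. [cite: LuenbergerYe2008, §3.6 Example] -/
theorem boundedExample_feasible : BoxFeasible exA exb exh exX := by
  refine ⟨?_, fun j => ?_⟩
  · ext i
    fin_cases i <;> simp [exA, exb, exX, mulVec, dotProduct, Fin.sum_univ_five] <;> norm_num
  · fin_cases j <;> norm_num [exX, exh]

/-- The relative costs at the final solution: `r = c − Aᵀλ = (−2, 0, −3, 0, 1)` — zero on the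
basic columns, nonpositive on the variables at their upper bound, nonnegative on the one at its
lower bound ("all reduced cost coefficients are nonnegative" in the `±` bookkeeping of the extended
tableau). [cite: LuenbergerYe2008, §3.6 Example (final tableau)] -/
theorem boundedExample_relCost : relCost exA exc exLam = ![-2, 0, -3, 0, 1] := by
  ext j
  rw [relCost_apply, mulVec_transpose]
  simp only [vecMul, dotProduct, Fin.sum_univ_two]
  fin_cases j <;> simp [exA, exc, exLam] <;> norm_num

/-- **Example (§3.6), conclusion.** The point `x = (7, 1, 1, 3, 0)` is optimal: every feasible
point of the Example costs at least as much — by the Upper Bound Optimality Theorem with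
`λ = (4, 1)`. [cite: LuenbergerYe2008, §3.6 Example ("this tableau represents an optimal
solution")] -/
theorem boundedExample_optimal {y : Fin 5 → ℝ} (hy : BoxFeasible exA exb exh y) :
    exc ⬝ᵥ exX ≤ exc ⬝ᵥ y := by
  refine upperBound_optimality exLam boundedExample_feasible (fun j => ?_) hy
  rw [boundedExample_relCost]
  fin_cases j
  · right; right; exact ⟨by simp [exX, exh], by simp⟩
  · left; simp
  · right; right; exact ⟨by simp [exX, exh], by simp⟩
  · left; simp
  · right; left; exact ⟨by simp [exX], by simp⟩

/-- The optimal value of the Example is `cᵀx = 12`. [cite: LuenbergerYe2008, §3.6 Example] -/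
theorem boundedExample_value : exc ⬝ᵥ exX = 12 := by
  simp [exc, exX, dotProduct, Fin.sum_univ_five]
  norm_num

end Literature.Analysis.Convex.SimplexUpperBounds
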